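import Mathlib.MeasureTheory.Integral.Bochner.Basic
import Mathlib.MeasureTheory.Function.L2Space
import Mathlib.Analysis.SpecialFunctions.Log.Basic
import Mathlib.Analysis.SpecialFunctions.Pow.Real
import Literature.Analysis.ODE.OneSidedComparison
import HarnessLib

/-!
# Nash's logarithmic moment inequality (Chen–Strain–Tsai–Yau 2009, §5.3; Lei–Zhang 2011, Lemma 3.1)

Analysis/FluidPDE proofs file (theorems only, no definitions, no named facts): the elementary
inequality behind Nash's lower bound for positive solutions of parabolic equations, in the form
printed by Chen–Strain–Tsai–Yau, *Lower bounds on the blow-up rate of the axisymmetric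
Navier–Stokes equations II*, Comm. PDE 34 (2009) = arXiv:0709.4230, §5.3 ("Nash inequality"),
and quoted as **Lemma 3.1** by Lei–Zhang, J. Funct. Anal. 261 (2011) = arXiv:1011.5066, p. 9:

"Let `M ≥ 1` be a constant and `μ` be a probability measure. Then for all `0 ≤ f ≤ M`, there
holds `|ln ∫ f dμ − ∫ ln f dμ| ≤ M ‖g‖_{L²} / ∫ f dμ`, where `g = ln f − ∫ ln f dμ`."

It is the third ingredient of §3 of Lei–Zhang (proof of their Theorem 1.1, step 1 of the
printed proof of Theorem 1.2 = the named fact `LeiZhang2011_liouville` of the tree), used in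
Lemma 3.2 there with `f = Φ̃(·, t)`, `dμ = ζ² dx`, `M = 2`.

## Statement and proof

`abs_log_integral_sub_integral_log_le`: for a probability measure `μ`, `0 < f ≤ M` pointwise and
`ln f ∈ L²(μ)`, `|ln ∫ f dμ − ∫ ln f dμ| ≤ M ‖g‖_{L²(μ)} / ∫ f dμ` with
`‖g‖_{L²(μ)} = (∫ (ln f − ∫ ln f dμ)² dμ)^{1/2}`. (The printed `M ≥ 1` is not needed; `f > 0` is
what makes `ln f` meaningful, and `ln f ∈ L²` is implicit in print.) CSTY differentiate
`β ↦ ln ∫ e^{βg} dμ`; we use instead the two convexity inequalities this derivative encodes,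
which avoids differentiating under the integral sign: with `m = ∫ ln f dμ`, `g = ln f − m`,
`f = e^m e^g` and `Z = ∫ e^g dμ = e^{-m} ∫ f dμ`,
* `Z ≥ ∫ (1 + g) dμ = 1` (`e^x ≥ 1 + x`), so `ln ∫ f dμ − m = ln Z ≥ 0` (Jensen);
* `Z ln Z ≤ ∫ g e^g dμ` (`x eˣ ≥ eˣ − 1` applied to `g − ln Z`: Gibbs' inequality), and
  `∫ g e^g dμ = e^{-m} ∫ g f dμ ≤ e^{-m} ‖g‖₂ ‖f‖₂ ≤ e^{-m} ‖g‖₂ (M ∫ f dμ)^{1/2}`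
  (Cauchy–Schwarz, `f² ≤ M f`), whence `ln Z ≤ ‖g‖₂ (M / ∫ f dμ)^{1/2} ≤ M ‖g‖₂ / ∫ f dμ`
  because `∫ f dμ ≤ M`.

## References

* C.-C. Chen, R. M. Strain, T.-P. Tsai, H.-T. Yau, Comm. PDE 34 (2009) 203–232 =
  arXiv:0709.4230, §5.3. [ChenStrainTsaiYau2009]
* Z. Lei, Q. S. Zhang, J. Funct. Anal. 261 (2011) 2323–2345 = arXiv:1011.5066, Lemma 3.1 (p. 9).
  [LeiZhang2011]
-/

noncomputable section

open MeasureTheory Set Filter Real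

namespace Literature.Analysis.FluidPDE

variable {α : Type*} [MeasurableSpace α] {μ : Measure α}

/-- **Gibbs' inequality in moment form**: for a probability measure `μ` and `g` with `e^g`
and `g e^g` integrable, `Z ln Z ≤ ∫ g e^g dμ` where `Z = ∫ e^g dμ` (nonnegativity of the
relative entropy of `e^g dμ / Z` with respect to `μ`; from `x eˣ ≥ eˣ − 1`, the tree's
`Literature.Analysis.ODE.exp_sub_one_le_mul_exp`). [folklore] -/
theorem integral_exp_mul_log_le_integral_mul_exp [IsProbabilityMeasure μ] {g : α → ℝ}
    (hexp : Integrable (fun x => exp (g x)) μ) (hgexp : Integrable (fun x => g x * exp (g x)) μ) :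
    (∫ x, exp (g x) ∂μ) * log (∫ x, exp (g x) ∂μ) ≤ ∫ x, g x * exp (g x) ∂μ := by
  set Z : ℝ := ∫ x, exp (g x) ∂μ with hZ
  have hZpos : 0 < Z := integral_exp_pos hexp
  -- `∫ (g - log Z) e^g ≥ ∫ (e^g - Z) = 0`, from `h e^h ≥ e^h - 1` with `h = g - log Z`
  have hpt : ∀ x, exp (g x) - Z ≤ (g x - log Z) * exp (g x) := by
    intro x
    have h := Literature.Analysis.ODE.exp_sub_one_le_mul_exp (g x - log Z)
    have e1 : exp (g x - log Z) = exp (g x) / Z := by rw [exp_sub, exp_log hZpos]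
    rw [e1] at h
    have h2 := mul_le_mul_of_nonneg_right h hZpos.le
    rw [sub_mul, div_mul_cancel₀ _ hZpos.ne', one_mul, mul_assoc, div_mul_cancel₀ _ hZpos.ne']
      at h2
    exact h2
  have hint1 : Integrable (fun x => exp (g x) - Z) μ := hexp.sub (integrable_const Z)
  have hint2 : Integrable (fun x => (g x - log Z) * exp (g x)) μ := by
    have : (fun x => (g x - log Z) * exp (g x)) = fun x => g x * exp (g x) - log Z * exp (g x) := by
      funext x; ring
    rw [this]
    exact hgexp.sub (hexp.const_mul _)
  have hmono := integral_mono hint1 hint2 hpt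
  have hl : ∫ x, (exp (g x) - Z) ∂μ = 0 := by
    rw [integral_sub hexp (integrable_const Z), integral_const, probReal_univ, one_smul,
      sub_self]
  have hr : ∫ x, (g x - log Z) * exp (g x) ∂μ = (∫ x, g x * exp (g x) ∂μ) - log Z * Z := by
    have : (fun x => (g x - log Z) * exp (g x)) = fun x => g x * exp (g x) - log Z * exp (g x) := by
      funext x; ring
    rw [this, integral_sub hgexp (hexp.const_mul _), integral_const_mul]
  rw [hl, hr] at hmono
  linarith [mul_comm Z (log Z)]

/-- **Nash's inequality (Chen–Strain–Tsai–Yau 2009, §5.3; Lei–Zhang 2011, Lemma 3.1).** Let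
`μ` be a probability measure and `0 < f ≤ M` with `ln f ∈ L²(μ)`. Then
`|ln ∫ f dμ − ∫ ln f dμ| ≤ M ‖g‖_{L²(μ)} / ∫ f dμ`, `g = ln f − ∫ ln f dμ`, with
`‖g‖_{L²(μ)} = (∫ g² dμ)^{1/2}`. (Printed with the hypothesis `M ≥ 1`, which is not used.) See
the module docstring for the proof. [cite: ChenStrainTsaiYau2009, §5.3 (Nash inequality); LeiZhang2011, Lemma 3.1 (arXiv p. 9)] -/
theorem abs_log_integral_sub_integral_log_le [IsProbabilityMeasure μ] {f : α → ℝ} {M : ℝ}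
    (hf0 : ∀ x, 0 < f x) (hfM : ∀ x, f x ≤ M) (hlog : MemLp (fun x => log (f x)) 2 μ) :
    |log (∫ x, f x ∂μ) - ∫ x, log (f x) ∂μ| ≤
      M * Real.sqrt (∫ x, (log (f x) - ∫ y, log (f y) ∂μ) ^ 2 ∂μ) / ∫ x, f x ∂μ := by
  -- notation
  set m : ℝ := ∫ y, log (f y) ∂μ with hm
  set g : α → ℝ := fun x => log (f x) - m with hg
  -- measurability and integrability
  have hfeq : ∀ x, f x = exp m * exp (g x) := fun x => by
    rw [hg, ← exp_add, add_sub_cancel, exp_log (hf0 x)]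
  have hgm : MemLp g 2 μ := hlog.sub (memLp_const m)
  have hgi : Integrable g μ := hgm.integrable one_le_two
  have hgsm : AEStronglyMeasurable g μ := hgm.1
  have hexpm : AEStronglyMeasurable (fun x => exp (g x)) μ :=
    continuous_exp.comp_aestronglyMeasurable hgsm
  have hexp_bd : ∀ x, exp (g x) ≤ M * exp (-m) := fun x => by
    have := hfM x
    rw [hfeq x] at this
    calc exp (g x) = exp (-m) * (exp m * exp (g x)) := by
          rw [← mul_assoc, ← exp_add, neg_add_cancel, exp_zero, one_mul]
      _ ≤ exp (-m) * M := mul_le_mul_of_nonneg_left this (exp_pos _).le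
      _ = M * exp (-m) := mul_comm _ _
  have hexp : Integrable (fun x => exp (g x)) μ :=
    Integrable.of_bound hexpm (M * exp (-m)) (ae_of_all μ fun x => by
      rw [Real.norm_eq_abs, abs_of_pos (exp_pos _)]; exact hexp_bd x)
  have hgexp : Integrable (fun x => g x * exp (g x)) μ :=
    hgi.mul_bdd hexpm (ae_of_all μ fun x => by
      rw [Real.norm_eq_abs, abs_of_pos (exp_pos _)]; exact hexp_bd x)
  have hfm : AEStronglyMeasurable f μ := by
    have : f = fun x => exp m * exp (g x) := funext hfeq
    rw [this]
    exact hexpm.const_mul _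
  have hfi : Integrable f μ :=
    Integrable.of_bound hfm M (ae_of_all μ fun x => by
      rw [Real.norm_eq_abs, abs_of_pos (hf0 x)]; exact hfM x)
  -- `Z = ∫ e^g`, `∫ f = e^m Z`
  set Z : ℝ := ∫ x, exp (g x) ∂μ with hZ
  have hZpos : 0 < Z := integral_exp_pos hexp
  have hIf : ∫ x, f x ∂μ = exp m * Z := by
    rw [hZ, ← integral_const_mul]
    exact integral_congr_ae (ae_of_all μ hfeq)
  have hIpos : 0 < ∫ x, f x ∂μ := by rw [hIf]; positivity
  have hIleM : ∫ x, f x ∂μ ≤ M := by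
    calc ∫ x, f x ∂μ ≤ ∫ _, M ∂μ := integral_mono hfi (integrable_const M) hfM
      _ = M := by rw [integral_const, probReal_univ, one_smul]
  -- `∫ g = 0`
  have hg0 : ∫ x, g x ∂μ = 0 := by
    rw [hg, integral_sub (hlog.integrable one_le_two) (integrable_const m), integral_const,
      probReal_univ, one_smul, hm, sub_self]
  -- (i) `Z ≥ 1`, so `log ∫ f - m = log Z ≥ 0`
  have hZ1 : 1 ≤ Z := by
    have h1 : ∫ x, (g x + 1) ∂μ ≤ Z := integral_mono (hgi.add (integrable_const 1)) hexp
      fun x => add_one_le_exp (g x)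
    rwa [integral_add hgi (integrable_const 1), hg0, integral_const, probReal_univ,
      one_smul, zero_add] at h1
  have hlogI : log (∫ x, f x ∂μ) - m = log Z := by
    rw [hIf, log_mul (exp_pos m).ne' hZpos.ne', log_exp, add_sub_cancel_left]
  have hlogZ0 : 0 ≤ log Z := log_nonneg hZ1
  -- (ii) `Z log Z ≤ ∫ g e^g = e^{-m} ∫ g f`
  have hGibbs := integral_exp_mul_log_le_integral_mul_exp hexp hgexp
  -- (iii) Cauchy–Schwarz: `∫ g e^g ≤ ‖g‖₂ (∫ e^{2g})^{1/2}` and `e^{2g} ≤ M e^{-m} e^g`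
  set S : ℝ := ∫ x, (log (f x) - m) ^ 2 ∂μ with hS
  have hSg : S = ∫ x, g x ^ 2 ∂μ := rfl
  have hS0 : 0 ≤ S := integral_nonneg fun x => sq_nonneg _
  have hCS : ∫ x, g x * exp (g x) ∂μ ≤ Real.sqrt S * Real.sqrt (M * exp (-m) * Z) := by
    -- `∫ g e^g ≤ ∫ |g| e^g ≤ (∫ |g|²)^{1/2} (∫ (e^g)²)^{1/2}`
    have habs : MemLp (fun x => |g x|) (ENNReal.ofReal 2) μ := by
      rw [ENNReal.ofReal_ofNat]; exact hgm.abs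
    have hexp2 : MemLp (fun x => exp (g x)) (ENNReal.ofReal 2) μ := by
      rw [ENNReal.ofReal_ofNat]
      exact MemLp.of_bound hexpm (M * exp (-m)) (ae_of_all μ fun x => by
        rw [Real.norm_eq_abs, abs_of_pos (exp_pos _)]; exact hexp_bd x)
    have h1 : ∫ x, g x * exp (g x) ∂μ ≤ ∫ x, |g x| * exp (g x) ∂μ :=
      integral_mono hgexp (hgi.abs.mul_bdd hexpm (ae_of_all μ fun x => by
        rw [Real.norm_eq_abs, abs_of_pos (exp_pos _)]; exact hexp_bd x))
        fun x => mul_le_mul_of_nonneg_right (le_abs_self _) (exp_pos _).le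
    have h2 := integral_mul_le_Lp_mul_Lq_of_nonneg Real.HolderConjugate.two_two
      (ae_of_all μ fun x => abs_nonneg (g x)) (ae_of_all μ fun x => (exp_pos (g x)).le)
      habs hexp2
    have h3 : (∫ x, |g x| ^ (2 : ℝ) ∂μ) ^ (1 / (2 : ℝ)) = Real.sqrt S := by
      rw [Real.sqrt_eq_rpow, hSg]
      congr 1
      exact integral_congr_ae (ae_of_all μ fun x => by
        simp only [Real.rpow_two, sq_abs])
    have h4 : (∫ x, exp (g x) ^ (2 : ℝ) ∂μ) ^ (1 / (2 : ℝ)) ≤ Real.sqrt (M * exp (-m) * Z) := by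
      rw [Real.sqrt_eq_rpow]
      refine Real.rpow_le_rpow (integral_nonneg fun x => Real.rpow_nonneg (exp_pos _).le _) ?_
        (by norm_num)
      have hpt : ∀ x, exp (g x) ^ (2 : ℝ) ≤ M * exp (-m) * exp (g x) := fun x => by
        rw [Real.rpow_two, sq]
        exact mul_le_mul_of_nonneg_right (hexp_bd x) (exp_pos _).le
      calc ∫ x, exp (g x) ^ (2 : ℝ) ∂μ ≤ ∫ x, M * exp (-m) * exp (g x) ∂μ :=
            integral_mono_of_nonneg (ae_of_all μ fun x => Real.rpow_nonneg (exp_pos _).le _)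
              (hexp.const_mul _) (ae_of_all μ hpt)
        _ = M * exp (-m) * Z := by rw [integral_const_mul]
    calc ∫ x, g x * exp (g x) ∂μ ≤ ∫ x, |g x| * exp (g x) ∂μ := h1
      _ ≤ (∫ x, |g x| ^ (2 : ℝ) ∂μ) ^ (1 / (2 : ℝ)) * (∫ x, exp (g x) ^ (2 : ℝ) ∂μ) ^ (1 / (2 : ℝ)) :=
          h2
      _ ≤ Real.sqrt S * Real.sqrt (M * exp (-m) * Z) := by
          rw [h3]
          exact mul_le_mul_of_nonneg_left h4 (Real.sqrt_nonneg _)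
  -- (iv) combine: `log Z ≤ √S √(M e^{-m} Z) / Z = √S √M / √(∫ f) ≤ M √S / ∫ f`
  have hkey : log Z ≤ M * Real.sqrt S / ∫ x, f x ∂μ := by
    have h1 : Z * log Z ≤ Real.sqrt S * Real.sqrt (M * exp (-m) * Z) := hGibbs.trans hCS
    -- `√(M e^{-m} Z) = √(M Z² / ∫ f)` and `√M / √(∫f) ≤ M / ∫ f`
    have h2 : Real.sqrt (M * exp (-m) * Z) = Z * Real.sqrt (M / ∫ x, f x ∂μ) := by
      rw [hIf, show M * exp (-m) * Z = Z ^ 2 * (M / (exp m * Z)) by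
        rw [exp_neg]; field_simp]
      rw [Real.sqrt_mul (sq_nonneg Z), Real.sqrt_sq hZpos.le]
    have h3 : Real.sqrt (M / ∫ x, f x ∂μ) ≤ M / ∫ x, f x ∂μ := by
      have hq : 1 ≤ M / ∫ x, f x ∂μ := by rwa [le_div_iff₀ hIpos, one_mul]
      calc Real.sqrt (M / ∫ x, f x ∂μ) ≤ Real.sqrt ((M / ∫ x, f x ∂μ) ^ 2) := by
            apply Real.sqrt_le_sqrt
            nlinarith
        _ = M / ∫ x, f x ∂μ := Real.sqrt_sq (zero_le_one.trans hq)
    rw [h2] at h1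
    have h4 : Z * log Z ≤ Z * (Real.sqrt S * (M / ∫ x, f x ∂μ)) := by
      calc Z * log Z ≤ Real.sqrt S * (Z * Real.sqrt (M / ∫ x, f x ∂μ)) := h1
        _ = Z * (Real.sqrt S * Real.sqrt (M / ∫ x, f x ∂μ)) := by ring
        _ ≤ Z * (Real.sqrt S * (M / ∫ x, f x ∂μ)) :=
            mul_le_mul_of_nonneg_left (mul_le_mul_of_nonneg_left h3 (Real.sqrt_nonneg _))
              hZpos.le
    have h5 := le_of_mul_le_mul_left h4 hZpos
    calc log Z ≤ Real.sqrt S * (M / ∫ x, f x ∂μ) := h5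
      _ = M * Real.sqrt S / ∫ x, f x ∂μ := by ring
  rw [hlogI, abs_of_nonneg hlogZ0]
  exact hkey

end Literature.Analysis.FluidPDE
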